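import Summits.QuantumFields.YangMills.Theses.LangevinControlUV

/-!
# `LatticeGapInUVUnits` (typed, `∀ a`) implies its repair `LatticeGapInUVUnitsC` (continuous unit maps)

Support edge for item stmt-QuantumFields-9366 (route `LangevinControlUV` of `YangMills`, support rank 5).

The typed item `LatticeGapInUVUnits` serves EVERY unit map `a` carrying the femto two-point package; its repair
C′ = `LatticeGapInUVUnitsC` (item stmt-QuantumFields-16206, the hypothesis `hIR` of the route's deciding theorem
`closes` since rev 15, 2026-08-16) serves only CONTINUOUS ones.  The edge below records in the kernel that the
repair is a WEAKENING of the typed statement: any proof of stmt-9366 closes stmt-16206 by this lemma, while the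
conditional refutation of the typed statement (`Negative/LatticeGapInUVUnitsFalseOfStandardScalingSU`,
`latticeGapInUVUnits_false_of_standardScalingSU : StandardScalingSU → ¬ LatticeGapInUVUnits`, whose witness is a
slowly, generically decaying STEP unit map — discontinuous) does not touch C′.  Together: stmt-9366 as typed is
`LatticeGapInUVUnitsC ∧ (typed-∀a residue)`, and only the first conjunct is wanted by `closes`.
-/

namespace Summit.QuantumFields.YangMills.Theorems.LatticeGapInUVUnits

open Summit.QuantumFields.YangMills.Theses.LangevinControlUV

/-- **The typed crux implies its continuous repair**: `LatticeGapInUVUnits → LatticeGapInUVUnitsC` — drop the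
hypothesis `Continuous a` and apply the typed statement at the same `G, r, a` and package. [folklore] -/
theorem latticeGapInUVUnitsC_of_latticeGapInUVUnits :
    LatticeGapInUVUnits → LatticeGapInUVUnitsC := by
  intro h G _ _ _ _ hG r a _ hP
  exact h G hG r a hP

end Summit.QuantumFields.YangMills.Theorems.LatticeGapInUVUnits
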